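import Summits.SmoothPoincare4.SmoothPoincare4.Theses.ConvexBisection
import Literature.Geometry.Symplectic.SteinBoundaryContactProofs
import Literature.Geometry.Symplectic.JConvexMaximumPrinciple
import Literature.AlgebraicTopology.SingularHomology.LocalHomologyVanishing

/-!
# `AcyclicBisectionExists` — negative-side support (1/4): witnesses, junk exclusion,
# load-bearing hypothesis, the degree guard

Support lemmas for the crux
`Summit.SmoothPoincare4.SmoothPoincare4.Theses.ConvexBisection.AcyclicBisectionExists`
(stmt-SmoothPoincare4-10508), from the standing disprover's work file
`Cruxes/AcyclicBisectionExists/Disproof.lean` (gen 2).  Everything is proved.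

* §0 `Witness M` — the ∃-body of the crux as a structure (data + the six point-set/contact
  conditions); `Witness.Acyclic` (the homological conjunct), one-sided `AcyclicLeft/Right`;
  `HasAcyclicSteinBisection M`; `acyclicBisectionExists_iff` (the crux, unfolded).
* §1 junk models: `steinStructureOfIsEmpty`, `hasAcyclicSteinBisection_of_isEmpty` (the ∃-body
  holds vacuously over the empty 4-manifold: the content of the crux starts at `Nonempty M`).
* §2 structure of witnesses: any witness forces `M` compact; the halves inherit `T2` / second
  countability; `seam = eᵢ '' ∂Wᵢ`; interiors never meet the other half; EMPTY SEAM ⇒ EMPTY `M`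
  (tree maximum principle `SteinStructure.exists_isBoundaryPoint`, no connectedness needed), so
  over a nonempty `M` the seam, both halves and both boundaries are nonempty, and every component
  of a half reaches the seam.
* §3 `acyclicBisectionExists_false_without_homotopyEquiv`: the hypothesis `M ≃ₕ S⁴` cannot be
  dropped (false at `M = ℝ⁴`).
* §4 `not_acyclicBisectionExistsAllDegrees`: the degree guard `0 < k` cannot be dropped (at
  `M = S⁴`, `H₀(W; ℚ) = 0` forces `W = ∅`).
-/

noncomputable section

-- the prescribed namespace `Summit.<P>.<Sub>.…` duplicates `SmoothPoincare4` (P = Sub)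
set_option linter.dupNamespace false

open scoped Manifold ContDiff Topology ContinuousMap
open Set Function CategoryTheory CategoryTheory.Limits
open Literature.Geometry.Symplectic Literature.AlgebraicTopology.SingularHomology

namespace Summit.SmoothPoincare4.SmoothPoincare4.Theorems.AcyclicBisectionExists.Negative

open Summit.SmoothPoincare4.SmoothPoincare4.Theses.ConvexBisection

/-- Local notation: the model space `ℝ⁴`. -/
local notation "𝔼4" => EuclideanSpace ℝ (Fin 4)
/-- Local notation: the round 4-sphere. -/
local notation "𝕊⁴" => (Metric.sphere (0 : EuclideanSpace ℝ (Fin 5)) 1)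

/-! ## §0 The ∃-body of the crux as a structure -/

/-- **A witness of the crux over `M`**: the data `(W₁, W₂, J₁, J₂, e₁, e₂)` of a Stein bisection of
`M` along a common contact seam, i.e. the ∃-body of `AcyclicBisectionExists` minus the homological
conjunct (which is `Witness.Acyclic`). [folklore] -/
structure Witness (M : Type) [TopologicalSpace M] [ChartedSpace 𝔼4 M] where
  /-- first half -/
  W₁ : Type
  [top₁ : TopologicalSpace W₁]
  [chart₁ : ChartedSpace (EuclideanHalfSpace 4) W₁]
  [mfd₁ : IsManifold (𝓡∂ 4) ∞ W₁]
  [cpt₁ : CompactSpace W₁]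
  /-- second half -/
  W₂ : Type
  [top₂ : TopologicalSpace W₂]
  [chart₂ : ChartedSpace (EuclideanHalfSpace 4) W₂]
  [mfd₂ : IsManifold (𝓡∂ 4) ∞ W₂]
  [cpt₂ : CompactSpace W₂]
  /-- the Stein structures -/
  J₁ : SteinStructure W₁
  J₂ : SteinStructure W₂
  /-- the embeddings -/
  e₁ : W₁ → M
  e₂ : W₂ → M
  emb₁ : Manifold.IsSmoothEmbedding (𝓡∂ 4) (𝓡 4) ∞ e₁
  emb₂ : Manifold.IsSmoothEmbedding (𝓡∂ 4) (𝓡 4) ∞ e₂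
  cover : range e₁ ∪ range e₂ = univ
  inter₁ : range e₁ ∩ range e₂ = e₁ '' (𝓡∂ 4).boundary W₁
  inter₂ : range e₁ ∩ range e₂ = e₂ '' (𝓡∂ 4).boundary W₂
  contact : ∀ w₁ w₂, e₁ w₁ = e₂ w₂ →
    Submodule.map (mfderiv (𝓡∂ 4) (𝓡 4) e₁ w₁).toLinearMap (contactPlane J₁.J w₁) =
      Submodule.map (mfderiv (𝓡∂ 4) (𝓡 4) e₂ w₂).toLinearMap (contactPlane J₂.J w₂)

attribute [instance] Witness.top₁ Witness.chart₁ Witness.mfd₁ Witness.cpt₁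
  Witness.top₂ Witness.chart₂ Witness.mfd₂ Witness.cpt₂

namespace Witness

variable {M : Type} [TopologicalSpace M] [ChartedSpace 𝔼4 M]

/-- The homological conjunct of the crux: both halves are ℚ-acyclic in positive degrees. [folklore] -/
def Acyclic (B : Witness M) : Prop :=
  ∀ k, 0 < k → IsZero (singularHomology ℚ ℚ B.W₁ k) ∧ IsZero (singularHomology ℚ ℚ B.W₂ k)

/-- One-sided acyclicity: only the FIRST half is ℚ-acyclic in positive degrees. [folklore] -/
def AcyclicLeft (B : Witness M) : Prop :=
  ∀ k, 0 < k → IsZero (singularHomology ℚ ℚ B.W₁ k)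

/-- One-sided acyclicity: only the SECOND half is ℚ-acyclic in positive degrees. [folklore] -/
def AcyclicRight (B : Witness M) : Prop :=
  ∀ k, 0 < k → IsZero (singularHomology ℚ ℚ B.W₂ k)

/-- The left half of an acyclic witness is acyclic. [folklore] -/
theorem Acyclic.left {B : Witness M} (hB : B.Acyclic) : B.AcyclicLeft := fun k hk => (hB k hk).1
/-- The right half of an acyclic witness is acyclic. [folklore] -/
theorem Acyclic.right {B : Witness M} (hB : B.Acyclic) : B.AcyclicRight := fun k hk => (hB k hk).2
/-- Acyclicity is the conjunction of the two one-sided conditions. [folklore] -/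
theorem acyclic_iff (B : Witness M) : B.Acyclic ↔ B.AcyclicLeft ∧ B.AcyclicRight :=
  ⟨fun h => ⟨h.left, h.right⟩, fun h k hk => ⟨h.1 k hk, h.2 k hk⟩⟩

/-- The strengthened conjunct WITHOUT the degree guard `0 < k` (see §4). [folklore] -/
def AcyclicAllDegrees (B : Witness M) : Prop :=
  ∀ k, IsZero (singularHomology ℚ ℚ B.W₁ k) ∧ IsZero (singularHomology ℚ ℚ B.W₂ k)

/-- The seam `e₁(W₁) ∩ e₂(W₂)`. [folklore] -/
def seam (B : Witness M) : Set M := range B.e₁ ∩ range B.e₂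

end Witness

/-- **The ∃-body of the crux as a predicate on `M`.** [folklore] -/
def HasAcyclicSteinBisection (M : Type) [TopologicalSpace M] [ChartedSpace 𝔼4 M] : Prop :=
  ∃ B : Witness M, B.Acyclic

/-- The crux, unfolded: `AcyclicBisectionExists ↔ ∀ M ≃ₕ S⁴, HasAcyclicSteinBisection M`.
[folklore] -/
theorem acyclicBisectionExists_iff :
    AcyclicBisectionExists ↔
      ∀ (M : Type) [TopologicalSpace M] [T2Space M] [SecondCountableTopology M]
        [ChartedSpace 𝔼4 M] [IsManifold (𝓡 4) ∞ M], M ≃ₕ 𝕊⁴ → HasAcyclicSteinBisection M := by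
  constructor
  · intro h M _ _ _ _ _ f
    obtain ⟨W₁, _, _, _, _, W₂, _, _, _, _, J₁, J₂, e₁, e₂, h1, h2, h3, h4, h5, h6, h7⟩ := h M f
    exact ⟨⟨W₁, W₂, J₁, J₂, e₁, e₂, h1, h2, h3, h4, h5, h6⟩, h7⟩
  · intro h M _ _ _ _ _ f
    obtain ⟨B, hB⟩ := h M f
    exact ⟨B.W₁, inferInstance, inferInstance, inferInstance, inferInstance, B.W₂, inferInstance,
      inferInstance, inferInstance, inferInstance, B.J₁, B.J₂, B.e₁, B.e₂, B.emb₁, B.emb₂, B.cover,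
      B.inter₁, B.inter₂, B.contact, hB⟩

/-! ## §1 Junk models -/

/-- The empty type is vacuously a Stein domain (all fields quantify over points). [folklore] -/
def steinStructureOfIsEmpty (W : Type*) [TopologicalSpace W] [ChartedSpace (EuclideanHalfSpace 4) W]
    [IsManifold (𝓡∂ 4) ∞ W] [CompactSpace W] [IsEmpty W] : SteinStructure W where
  J := fun x => isEmptyElim x
  φ := fun x => isEmptyElim x
  J_sq := fun x => isEmptyElim x
  J_smooth := fun _ _ x => isEmptyElim x
  integrable := fun _ _ _ _ x => isEmptyElim x
  φ_smooth := fun x => isEmptyElim x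
  convex := fun x => isEmptyElim x
  boundary_eq := fun x => isEmptyElim x
  regular := fun x => isEmptyElim x

/-- The empty charted space over the half-space (Mathlib `ChartedSpace.empty`; the `C^∞`
structure is Mathlib's instance `IsManifold.empty`). [folklore] -/
instance : ChartedSpace (EuclideanHalfSpace 4) Empty := ChartedSpace.empty _ _

/-- **Junk inhabitant.** Over an EMPTY `M` the ∃-body holds (both halves empty): the content of
the crux starts at `Nonempty M` (automatic for `M ≃ₕ S⁴`). [folklore] -/
theorem hasAcyclicSteinBisection_of_isEmpty (M : Type) [TopologicalSpace M] [ChartedSpace 𝔼4 M]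
    [IsManifold (𝓡 4) ∞ M] [IsEmpty M] : HasAcyclicSteinBisection M := by
  refine ⟨⟨Empty, Empty, steinStructureOfIsEmpty Empty, steinStructureOfIsEmpty Empty,
    Empty.elim, Empty.elim, ?_, ?_, ?_, ?_, ?_, ?_⟩, ?_⟩
  · exact ⟨⟨ℝ, inferInstance, inferInstance, fun x => isEmptyElim x⟩, .of_subsingleton _⟩
  · exact ⟨⟨ℝ, inferInstance, inferInstance, fun x => isEmptyElim x⟩, .of_subsingleton _⟩
  · exact Subsingleton.elim _ _
  · ext x; exact isEmptyElim x
  · ext x; exact isEmptyElim x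
  · intro w; exact w.elim
  · intro k hk
    exact ⟨isZero_singularHomology_of_subsingleton (X := Empty) ℚ ℚ (Nat.pos_iff_ne_zero.1 hk),
      isZero_singularHomology_of_subsingleton (X := Empty) ℚ ℚ (Nat.pos_iff_ne_zero.1 hk)⟩

/-! ## §2 Structure of witnesses -/

namespace Witness

variable {M : Type} [TopologicalSpace M] [ChartedSpace 𝔼4 M] (B : Witness M)

/-- The first embedding is continuous. [folklore] -/
theorem continuous_e₁ : Continuous B.e₁ := B.emb₁.isEmbedding.continuous
/-- The second embedding is continuous. [folklore] -/
theorem continuous_e₂ : Continuous B.e₂ := B.emb₂.isEmbedding.continuous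
/-- The first embedding is injective. [folklore] -/
theorem injective_e₁ : Injective B.e₁ := B.emb₁.isEmbedding.injective
/-- The second embedding is injective. [folklore] -/
theorem injective_e₂ : Injective B.e₂ := B.emb₂.isEmbedding.injective
/-- The image of the first half is compact. [folklore] -/
theorem isCompact_range_e₁ : IsCompact (range B.e₁) := isCompact_range B.continuous_e₁
/-- The image of the second half is compact. [folklore] -/
theorem isCompact_range_e₂ : IsCompact (range B.e₂) := isCompact_range B.continuous_e₂

/-- **Any witness forces `M` to be compact** (`M` is the union of two compact images). [folklore] -/
theorem compactSpace (B : Witness M) : CompactSpace M :=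
  ⟨by rw [← B.cover]; exact B.isCompact_range_e₁.union B.isCompact_range_e₂⟩

/-- The halves inherit the Hausdorff property from `M` (they embed). [folklore] -/
theorem t2Space₁ [T2Space M] : T2Space B.W₁ := B.emb₁.isEmbedding.t2Space

/-- The second half is Hausdorff when `M` is. [folklore] -/
theorem t2Space₂ [T2Space M] : T2Space B.W₂ := B.emb₂.isEmbedding.t2Space

/-- The halves inherit second countability from `M` (they embed). [folklore] -/
theorem secondCountableTopology₁ [SecondCountableTopology M] : SecondCountableTopology B.W₁ :=
  B.emb₁.isEmbedding.secondCountableTopology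

/-- The second half is second countable when `M` is. [folklore] -/
theorem secondCountableTopology₂ [SecondCountableTopology M] : SecondCountableTopology B.W₂ :=
  B.emb₂.isEmbedding.secondCountableTopology

/-- The seam is the image of `∂W₁`. [folklore] -/
theorem seam_eq_image₁ : B.seam = B.e₁ '' (𝓡∂ 4).boundary B.W₁ := B.inter₁
/-- The seam is the image of `∂W₂`. [folklore] -/
theorem seam_eq_image₂ : B.seam = B.e₂ '' (𝓡∂ 4).boundary B.W₂ := B.inter₂
/-- The seam lies in the first half. [folklore] -/
theorem seam_subset_range_e₁ : B.seam ⊆ range B.e₁ := inter_subset_left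
/-- The seam lies in the second half. [folklore] -/
theorem seam_subset_range_e₂ : B.seam ⊆ range B.e₂ := inter_subset_right
/-- The seam is compact. [folklore] -/
theorem isCompact_seam : IsCompact B.seam := by
  rw [seam_eq_image₁]
  exact ((ModelWithCorners.isClosed_boundary (I := 𝓡∂ 4) (M := B.W₁) (n := ∞) (by simp)).isCompact).image
    B.continuous_e₁

/-- A point of `W₁` mapped into `e₂(W₂)` is a boundary point of `W₁`. [folklore] -/
theorem mem_boundary₁_of_mem_range (w : B.W₁) (h : B.e₁ w ∈ range B.e₂) :
    w ∈ (𝓡∂ 4).boundary B.W₁ := by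
  have : B.e₁ w ∈ B.e₁ '' (𝓡∂ 4).boundary B.W₁ := by
    rw [← B.inter₁]; exact ⟨mem_range_self w, h⟩
  obtain ⟨w', hw', he⟩ := this
  exact B.injective_e₁ he ▸ hw'

/-- A point of `W₂` mapped into `e₁(W₁)` is a boundary point of `W₂`. [folklore] -/
theorem mem_boundary₂_of_mem_range (w : B.W₂) (h : B.e₂ w ∈ range B.e₁) :
    w ∈ (𝓡∂ 4).boundary B.W₂ := by
  have : B.e₂ w ∈ B.e₂ '' (𝓡∂ 4).boundary B.W₂ := by
    rw [← B.inter₂]; exact ⟨h, mem_range_self w⟩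
  obtain ⟨w', hw', he⟩ := this
  exact B.injective_e₂ he ▸ hw'

/-- **Interior points are never seam points**: `e₁ (Int W₁) ∩ e₂ (W₂) = ∅`, i.e. the two
halves overlap exactly along the seam (the intended `Σ = W₁ ∪_Γ W̄₂` shape; no thick overlaps).
[folklore] -/
theorem image_interior₁_inter_range_e₂ :
    B.e₁ '' (𝓡∂ 4).interior B.W₁ ∩ range B.e₂ = ∅ := by
  ext p
  simp only [mem_inter_iff, mem_image, mem_empty_iff_false, iff_false, not_and]
  rintro ⟨w, hw, rfl⟩ hp
  have hb := B.mem_boundary₁_of_mem_range w hp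
  rw [← ModelWithCorners.compl_interior] at hb
  exact hb hw

/-- The seam points seen from `W₁`, resp. `W₂`: `e₁ w₁ = e₂ w₂` forces both to be boundary
points (so the contact condition of the crux only ever speaks about boundary points, where
`contactPlane` is meaningful). [folklore] -/
theorem mem_boundary_of_eq {w₁ : B.W₁} {w₂ : B.W₂} (h : B.e₁ w₁ = B.e₂ w₂) :
    w₁ ∈ (𝓡∂ 4).boundary B.W₁ ∧ w₂ ∈ (𝓡∂ 4).boundary B.W₂ :=
  ⟨B.mem_boundary₁_of_mem_range w₁ ⟨w₂, h.symm⟩, B.mem_boundary₂_of_mem_range w₂ ⟨w₁, h⟩⟩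

/-- **Empty seam forces empty `M`.**  If the seam is empty then `∂W₁ = ∅ = ∂W₂`
(`seam = eᵢ '' ∂Wᵢ`), so by the tree's PROVED `J`-convex maximum principle
(`SteinStructure.exists_isBoundaryPoint`: a nonempty compact Stein domain has a boundary point)
both halves are empty, hence so is `M = e₁ W₁ ∪ e₂ W₂`.  No connectedness or separation
hypothesis on `M` is needed. [folklore] -/
theorem isEmpty_of_seam_eq_empty (h : B.seam = ∅) : IsEmpty M := by
  have h1 : IsEmpty B.W₁ := by
    by_contra hne
    rw [not_isEmpty_iff] at hne
    obtain ⟨x, hx⟩ := B.J₁.exists_isBoundaryPoint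
    have : B.e₁ x ∈ B.seam := by rw [seam_eq_image₁]; exact mem_image_of_mem _ hx
    rw [h] at this
    exact this
  have h2 : IsEmpty B.W₂ := by
    by_contra hne
    rw [not_isEmpty_iff] at hne
    obtain ⟨x, hx⟩ := B.J₂.exists_isBoundaryPoint
    have : B.e₂ x ∈ B.seam := by rw [seam_eq_image₂]; exact mem_image_of_mem _ hx
    rw [h] at this
    exact this
  refine ⟨fun p => ?_⟩
  have hp : p ∈ range B.e₁ ∪ range B.e₂ := by rw [B.cover]; exact mem_univ p
  rcases hp with ⟨w, -⟩ | ⟨w, -⟩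
  · exact h1.false w
  · exact h2.false w

/-- **Over a nonempty `M` the seam of every witness is nonempty** (sharper than the informal
"by connectedness": only the maximum principle is used). [folklore] -/
theorem seam_nonempty [Nonempty M] : B.seam.Nonempty := by
  by_contra h
  rw [not_nonempty_iff_eq_empty] at h
  exact (B.isEmpty_of_seam_eq_empty h).false (Classical.arbitrary M)

/-- Over a nonempty `M` both halves of every witness are nonempty. [folklore] -/
theorem halves_nonempty [Nonempty M] : Nonempty B.W₁ ∧ Nonempty B.W₂ := by
  obtain ⟨p, ⟨w₁, -⟩, ⟨w₂, -⟩⟩ := B.seam_nonempty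
  exact ⟨⟨w₁⟩, ⟨w₂⟩⟩

/-- Over a nonempty `M` both halves have nonempty boundary: one-piece "bisections"
(`W₂ = ∅`, `W₁ = M` recharted, closed Stein pieces) are excluded by the statement itself.
[folklore] -/
theorem boundaries_nonempty [Nonempty M] :
    ((𝓡∂ 4).boundary B.W₁).Nonempty ∧ ((𝓡∂ 4).boundary B.W₂).Nonempty := by
  obtain ⟨p, hp⟩ := B.seam_nonempty
  have h1 := hp; have h2 := hp
  rw [seam_eq_image₁] at h1
  rw [seam_eq_image₂] at h2
  obtain ⟨w₁, hw₁, -⟩ := h1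
  obtain ⟨w₂, hw₂, -⟩ := h2
  exact ⟨⟨w₁, hw₁⟩, ⟨w₂, hw₂⟩⟩

/-- **Every connected component of either half reaches the seam** (tree:
`SteinStructure.exists_isBoundaryPoint_mem_connectedComponent`, the `J`-convex maximum principle
on a compact open component).  Hence `H₀(Wᵢ, ∂Wᵢ) = 0` in any witness: the halves have no closed
components, and the homological bookkeeping of the route (MV in the homology sphere) sees every
component of `Wᵢ` through the seam. [folklore] -/
theorem connectedComponent_meets_seam₁ [T2Space M] (w : B.W₁) :
    ∃ w' ∈ connectedComponent w, B.e₁ w' ∈ B.seam := by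
  haveI := B.t2Space₁
  obtain ⟨w', hw', hb⟩ := B.J₁.exists_isBoundaryPoint_mem_connectedComponent w
  exact ⟨w', hw', by rw [seam_eq_image₁]; exact mem_image_of_mem _ hb⟩

/-- Every connected component of `W₂` reaches the seam (maximum principle). [folklore] -/
theorem connectedComponent_meets_seam₂ [T2Space M] (w : B.W₂) :
    ∃ w' ∈ connectedComponent w, B.e₂ w' ∈ B.seam := by
  haveI := B.t2Space₂
  obtain ⟨w', hw', hb⟩ := B.J₂.exists_isBoundaryPoint_mem_connectedComponent w
  exact ⟨w', hw', by rw [seam_eq_image₂]; exact mem_image_of_mem _ hb⟩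

end Witness

/-! ## §3 Load-bearing hypothesis: the homotopy-sphere hypothesis cannot be dropped -/

/-- **Any proof must use `M ≃ₕ S⁴` (at least its consequence `CompactSpace M`)**: the crux with
the hypothesis `M ≃ₕ S⁴` DROPPED — "every (Hausdorff, second countable) smooth 4-manifold has a
ℚ-acyclic Stein bisection along a common contact seam" — is false at `M = ℝ⁴`, which is not
compact, while every witness forces compactness (`Witness.compactSpace`).  (The finer statement —
false also for CLOSED simply connected `M` — is `not_hasAcyclicSteinBisection_complexProjectivePlane`.)
[folklore] -/
theorem acyclicBisectionExists_false_without_homotopyEquiv :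
    ¬ ∀ (M : Type) [TopologicalSpace M] [T2Space M] [SecondCountableTopology M]
      [ChartedSpace 𝔼4 M] [IsManifold (𝓡 4) ∞ M], HasAcyclicSteinBisection M := by
  intro h
  obtain ⟨B, -⟩ := h 𝔼4
  exact (not_compactSpace_iff.2 (inferInstance : NoncompactSpace 𝔼4)) B.compactSpace

/-! ## §4 Refuted strengthening: the degree guard `0 < k` is not removable -/

/-- `H₀(X; ℚ) = 0` forces `X = ∅` (the augmentation `ε : H₀(X; ℚ) → ℚ` is onto for nonempty `X`,
tree `singularHomology.epi_ε_of_nonempty`). [folklore] -/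
theorem isEmpty_of_isZero_singularHomology_zero {X : Type} [TopologicalSpace X]
    (h : IsZero (singularHomology ℚ ℚ X 0)) : IsEmpty X := by
  by_contra hne
  rw [not_isEmpty_iff] at hne
  haveI := singularHomology.epi_ε_of_nonempty (R := ℚ) (M := ℚ) (X := X)
  have hz : IsZero (ModuleCat.of ℚ (ULift.{0} ℚ)) := h.of_epi (singularHomology.ε ℚ ℚ X)
  have key := congrArg (fun f : ModuleCat.of ℚ (ULift.{0} ℚ) ⟶ ModuleCat.of ℚ (ULift.{0} ℚ) =>
    (f.hom (ULift.up 1)).down) (hz.eq_of_src (𝟙 _) 0)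
  simp at key

/-- **The guard `0 < k` is load-bearing**: the crux with the degree guard dropped (both halves
ℚ-acyclic in ALL degrees, including `k = 0`) is false already at the round `S⁴` — `H₀(W₁; ℚ) = 0`
forces `W₁ = ∅`, then the seam is empty, so `M = ∅` (`Witness.isEmpty_of_seam_eq_empty`), but
`S⁴ ≠ ∅`. [folklore] -/
theorem not_acyclicBisectionExistsAllDegrees :
    ¬ ∀ (M : Type) [TopologicalSpace M] [T2Space M] [SecondCountableTopology M]
      [ChartedSpace 𝔼4 M] [IsManifold (𝓡 4) ∞ M], M ≃ₕ 𝕊⁴ → ∃ B : Witness M, B.AcyclicAllDegrees := by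
  intro h
  obtain ⟨B, hB⟩ := h 𝕊⁴ (ContinuousMap.HomotopyEquiv.refl _)
  have h1 : IsEmpty B.W₁ := isEmpty_of_isZero_singularHomology_zero (hB 0).1
  have hs : B.seam = ∅ := by
    rw [B.seam_eq_image₁]; exact image_eq_empty.2 (eq_empty_of_isEmpty _)
  haveI := B.isEmpty_of_seam_eq_empty hs
  have p : 𝕊⁴ := ⟨EuclideanSpace.single 0 1, by simp⟩
  exact IsEmpty.false p

end Summit.SmoothPoincare4.SmoothPoincare4.Theorems.AcyclicBisectionExists.Negative
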